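import Summits.BirchSwinnertonDyer.BirchSwinnertonDyer.Theorems.SignedLowerHalvesSmallImageLowerHalfBothSignsRttD2SeqJ3HSolLFree
import HarnessLib

/-!
# Route `SignedLowerHalves`, crux L `SmallImageLowerHalfBothSigns` (stmt-BirchSwinnertonDyer-23599), line `rtt_w3` v21 → v22 — E2, row J3 in the LEAD's v22 DESIGN (D4):
# THE PINNED JUNCTION MAP `jv : B = I.H →ₗ[Λ_𝒪] DQ.X` ON ALL OF `B` (`DQ.toDual (jv b) = (𝓛.towerPairing I).pairing b`) — EXISTS, IS UNIQUE, and
# `Function.Exact (jv ∘ₗ B′.subtype) gX` for the LEAD's `M = Cofree θ F` (stub S2 of v22 modulo `hperf` + frame hypotheses)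

WIDTH seat `bsd-line-slh-p3-w3` g24 under LEAD `cruxlead-stmt-BirchSwinnertonDyer-23599` g12 (cell `bsd-ssimc`); helper `--supports stmt-BirchSwinnertonDyer-23599`.
THEOREMS ONLY (no definition, no named fact, no instance, no `sorry`). Answers the LEAD's Q1/Q2 (bus 02:05:52Z, memo `Lines/rtt_w3-MEMO-v22-design-g12.md` (D4)/S2) IN KERNEL:
(Q1) the pin determines `jv` uniquely and a `Λ_𝒪`-linear `jv` with the pin EXISTS on all of `B = I.H` (the `Φ` of g20's `exists_junction_linearMap`, p779548: `b ↦ toDual⁻¹(P b)`,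
`Λ_𝒪`-linear by `pairing_map_smul_eq` from `TowerPairing.pairing_X_smul/_C_smul`, which hold on ALL of `I.H` — no strictness, no reciprocity); the only CHOICES in `𝓛` are
`lam`/`hlam`. (Q2) exactness transfers from the `∃ j₀` form of J3 to `jv ∘ₗ B′.subtype` for ANY pinned `jv` (`toDual ∘ j₀ = strictPairing = pairing ∘ subtype = toDual ∘ jv ∘ subtype`,
`toDual` injective). HONEST FRAMING: S2 for `M = Cofree θ F` then holds modulo the hypotheses of `exists_junction_exact_cofree_lam_free` (frame + `hperf`). E2, crux L, crux M, BSD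
remain OPEN and are proved for NO curve.

* ★★ `existsUnique_junctionMap` — `∃! jv : I.H →ₗ[Λ_𝒪] DQ.X, ∀ b, DQ.toDual (jv b) = (𝓛.towerPairing I).pairing hstab b` (generic `M`, `𝓛`).
* ★★ `exact_comp_subtype_of_junction_pin` — (∃ j₀ on `B′` with `toDual ∘ j₀ = strictPairing` and `Exact j₀ gX`) ⇒ `Exact (jv ∘ₗ B′.subtype) gX` for every pinned `jv` (generic).
* ★★★ `exact_junctionMap_comp_subtype_cofree_lam_free` — S2 for the LEAD's data: every pinned `jv` has `Exact (jv ∘ₗ B′.subtype) gX`, `B′ = strictCarrier I (strictLevel S κ θ′ P S₀)`.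
References: [Kobayashi2003] Thm. 7.3 i); [Rubin2000] Thm. 1.7.3, §4.2; [GreenbergLNM1716] §1; [Kato2004Asterisque] §17.13; [Washington1997] §13.2.
-/

set_option autoImplicit false
set_option linter.dupNamespace false -- D-0017: single-problem summit, the namespace repeats the problem name by design
noncomputable section

open scoped Classical
open NumberField IsDedekindDomain Field Matrix CategoryTheory Function

namespace Summit.BirchSwinnertonDyer.BirchSwinnertonDyer.Theorems.SmallImageRttD2Seq

open Literature.NumberTheory.EllipticCurves Literature.NumberTheory.EllipticCurves.GreenbergSelmer Literature.NumberTheory.GaloisRepresentations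
  Literature.NumberTheory.GaloisRepresentations.DiscreteGaloisModule Literature.NumberTheory.GaloisCohomology
  Literature.NumberTheory.EllipticCurves.GreenbergVatsal2000 Literature.NumberTheory.ComplexMultiplication.EllipticUnits.JohnsonLeungKings2011
  Summit.BirchSwinnertonDyer.BirchSwinnertonDyer.Theorems.SmallImageCharSignedSelmer Summit.BirchSwinnertonDyer.BirchSwinnertonDyer.Theorems.SmallImageRttD2J1

/-! ## §1. The pinned junction map on all of `B = I.H` (generic) -/

section Jv

variable {K : Type} [Field K] [NumberField K] {p : ℕ} [Fact p.Prime] {κ : ZpExtension K p} {γ : absoluteGaloisGroup K}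
  (S : Set (PadicAlgCl p)) [FiniteDimensional ℚ_[p] (padicCoeffField S)]
  {M : Type} [AddCommGroup M] [DistribMulAction (absoluteGaloisGroup K) M] [TopologicalSpace M] [DiscreteTopology M]
  [Module (padicCoeffIntegers S) M] [SMulCommClass (absoluteGaloisGroup K) (padicCoeffIntegers S) M]
  {V : WeierstrassCurve K} {j : V.geomPrimaryTorsion p →+ M} {S₀ : Set (HeightOneSpectrum (𝓞 K))} {ε : ℤˣ}
  (D : SignedTransportDualDataSat κ γ M (padicCoeffIntegers S) V j S₀ ε)
  {v : HeightOneSpectrum (𝓞 K)} [DistribMulAction (absoluteGaloisGroup (v.adicCompletion K)) M]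
  [SMulCommClass (absoluteGaloisGroup (v.adicCompletion K)) (padicCoeffIntegers S) M]
  {γv : absoluteGaloisGroup (v.adicCompletion K)} (DQ : LocalCondDualData κ M (padicCoeffIntegers S) V j ε v γv)
  (hres : ∀ (σ : absoluteGaloisGroup (v.adicCompletion K)) (m : M), σ • m = resGalOfEmb (closureEmb (K := K) (v.adicCompletion K)) σ • m)
  (hvp : (p : 𝓞 K) ∈ v.asIdeal)
  {γB : absoluteGaloisGroup K} {θ' : absoluteGaloisGroup K →ₜ* (padicCoeffIntegers S)ˣ} {P : Set (HeightOneSpectrum (𝓞 K))}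
  (𝓛 : LayerPairing S M γv κ γB θ' P) (I : CycIwasawaCohomologyDataO S κ γB θ' P 1)
  (hstab : ∀ m : M, IsOpen (MulAction.stabilizer (absoluteGaloisGroup (v.adicCompletion K)) m : Set (absoluteGaloisGroup (v.adicCompletion K))))

omit [DistribMulAction (absoluteGaloisGroup K) M] [SMulCommClass (absoluteGaloisGroup K) (padicCoeffIntegers S) M] in
/-- ★★ **The pinned junction map EXISTS and is UNIQUE on all of `B = I.H`.** For the pinned `Λ_𝒪`-structure `instQ` on `DQ.X` there is exactly one `Λ_𝒪`-linear
`jv : I.H →ₗ[Λ_𝒪] DQ.X` with `DQ.toDual (jv b) = (𝓛.towerPairing I).pairing hstab b` for all `b`: `jv b := toDual⁻¹ (P b)` (the `Φ` of `exists_junction_linearMap`, p779548),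
`Λ_𝒪`-linear by `pairing_map_smul_eq` from the two intertwining laws `TowerPairing.pairing_X_smul` / `pairing_C_smul` (valid on ALL of `I.H`); unique since `toDual` is injective.
No strictness and no reciprocity is used. [cite: Kobayashi2003, Thm. 7.3 i)] [cite: GreenbergLNM1716, §1 (after Conj. 1.3)] [cite: Kato2004Asterisque, §17.13] -/
theorem existsUnique_junctionMap (instQ : Module (IwasawaAlgebraO S) DQ.X)
    (hιQ : ∀ (f : IwasawaAlgebra p) (x : DQ.X), (letI := instQ; iwasawaToIwasawaO S f • x) = f • x)
    (hCQ : ∀ (a : padicCoeffIntegers S) (x : DQ.X) (c : localCondInftySat κ M (padicCoeffIntegers S) V j ε v),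
      DQ.toDual (letI := instQ; (PowerSeries.C a : IwasawaAlgebraO S) • x) c = DQ.toDual x (scalarLocalSat κ M (padicCoeffIntegers S) V j ε v a c))
    (htor : ∀ m : M, ∃ k : ℕ, p ^ k • m = 0) (hv : AcSigned.IsNonsplitIn κ v) (hγv : κ.IsTopGenerator (resGalOfEmb (closureEmb (K := K) (v.adicCompletion K)) γv)) :
    letI := instQ
    ∃! jv : I.H →ₗ[IwasawaAlgebraO S] DQ.X, ∀ b : I.H, DQ.toDual (jv b) = (𝓛.towerPairing I).pairing hstab b := by
  letI := instQ
  let e : DQ.X ≃+ (localCondInftySat κ M (padicCoeffIntegers S) V j ε v →+ AddCircle (1 : ℚ)) := AddEquiv.ofBijective DQ.toDual DQ.bijective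
  have he : ∀ q, DQ.toDual (e.symm q) = q := fun q ↦ e.apply_symm_apply q
  let Φ : I.H →ₗ[IwasawaAlgebraO S] DQ.X :=
    { toFun := fun b ↦ e.symm ((𝓛.towerPairing I).pairing hstab b)
      map_add' := fun b b' ↦ by rw [map_add, map_add]
      map_smul' := fun F b ↦ by
        apply DQ.bijective.1
        rw [he, RingHom.id_apply, pairing_map_smul_eq S DQ ((𝓛.towerPairing I).pairing hstab) instQ hιQ hCQ htor hstab hv hγv
          (fun b c ↦ TowerPairing.pairing_X_smul _ hstab b c) (fun a b c ↦ TowerPairing.pairing_C_smul _ hstab a b c) F b] }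
  have hΦ : ∀ b, DQ.toDual (Φ b) = (𝓛.towerPairing I).pairing hstab b := fun b ↦ he _
  refine ⟨Φ, hΦ, fun jv' hjv' ↦ LinearMap.ext fun b ↦ DQ.bijective.1 ?_⟩
  rw [hjv' b, hΦ b]

/-- ★★ **Exactness transfers from the `∃ j₀` form of J3 to ANY pinned `jv`.** If on the strict carrier `B′` there is `j₀` with `toDual ∘ j₀ = strictPairing` and
`Function.Exact j₀ gX` (g22's junction theorems), then for every `jv : I.H →ₗ DQ.X` with the pin `toDual (jv b) = pairing b` one has `jv ∘ₗ B′.subtype = j₀`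
(`strictPairing = pairing ∘ subtype`, `toDual` injective), hence `Function.Exact (jv ∘ₗ B′.subtype) gX`. [cite: Kobayashi2003, Thm. 7.3 i)] [cite: Rubin2000, Thm. 1.7.3] -/
theorem exact_comp_subtype_of_junction_pin (instX : Module (IwasawaAlgebraO S) D.X) (instQ : Module (IwasawaAlgebraO S) DQ.X)
    (hιX : ∀ (f : IwasawaAlgebra p) (x : D.X), (letI := instX; iwasawaToIwasawaO S f • x) = f • x)
    (hιQ : ∀ (f : IwasawaAlgebra p) (x : DQ.X), (letI := instQ; iwasawaToIwasawaO S f • x) = f • x)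
    (hCX : ∀ (a : padicCoeffIntegers S) (x : D.X) (s : signedTransportSelmerInftySat κ M (padicCoeffIntegers S) V j S₀ ε),
      D.toDual (letI := instX; (PowerSeries.C a : IwasawaAlgebraO S) • x) s =
        D.toDual x ⟨GreenbergSelmer.scalarH1 κ.kerSubgroup M a s, scalarH1_mem_signedTransportSelmerInftySat κ M (padicCoeffIntegers S) V j S₀ ε a s.2⟩)
    (hCQ : ∀ (a : padicCoeffIntegers S) (x : DQ.X) (c : localCondInftySat κ M (padicCoeffIntegers S) V j ε v),
      DQ.toDual (letI := instQ; (PowerSeries.C a : IwasawaAlgebraO S) • x) c = DQ.toDual x (scalarLocalSat κ M (padicCoeffIntegers S) V j ε v a c))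
    (htor : ∀ m : M, ∃ k : ℕ, p ^ k • m = 0)
    (hstabK : ∀ m : M, IsOpen (MulAction.stabilizer (absoluteGaloisGroup K) m : Set (absoluteGaloisGroup K)))
    (hγ : κ.IsTopGenerator γ) (hv : AcSigned.IsNonsplitIn κ v) (hγv : κ.IsTopGenerator (resGalOfEmb (closureEmb (K := K) (v.adicCompletion K)) γv))
    (Str : ∀ n k : ℕ, AddSubgroup (cycLayerCohO S κ θ' P n k 1))
    (hStr : ∀ (n k : ℕ) (f : IwasawaAlgebraO S) (y : cycLayerCohO S κ θ' P n k 1), y ∈ Str n k →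
      (letI := cycLayerModuleO S κ γB θ' P (show 1 ≤ 2 by norm_num) n k; f • y) ∈ Str n k)
    (hJ3 : letI := instX; letI := instQ
      ∃ j₀ : strictCarrier I Str hStr →ₗ[IwasawaAlgebraO S] DQ.X, (∀ b : strictCarrier I Str hStr, DQ.toDual (j₀ b) = strictPairing 𝓛 I Str hStr hstab b) ∧
        Function.Exact j₀ (gXLinearMapO S D DQ hres hvp instX instQ hιX hιQ hCX hCQ htor hstabK hstab hγ hv hγv))
    (jv : letI := instQ; I.H →ₗ[IwasawaAlgebraO S] DQ.X) (hjv : ∀ b : I.H, DQ.toDual (jv b) = (𝓛.towerPairing I).pairing hstab b) :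
    letI := instX; letI := instQ
    Function.Exact (jv ∘ₗ (strictCarrier I Str hStr).subtype) (gXLinearMapO S D DQ hres hvp instX instQ hιX hιQ hCX hCQ htor hstabK hstab hγ hv hγv) := by
  letI := instX; letI := instQ
  obtain ⟨j₀, hj₀, hex⟩ := hJ3
  have e : jv ∘ₗ (strictCarrier I Str hStr).subtype = j₀ := LinearMap.ext fun b ↦ DQ.bijective.1 (by
    rw [LinearMap.comp_apply, Submodule.subtype_apply, hjv, hj₀]; rfl)
  rw [e]
  exact hex

end Jv

/-! ## §2. S2 of the v22 design for the LEAD's `M = Cofree θ F` -/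

section Cofree

variable {K : Type} [Field K] [NumberField K] {p : ℕ} [Fact p.Prime] {κ : ZpExtension K p} {γ : absoluteGaloisGroup K}
  (S : Set (PadicAlgCl p)) [FiniteDimensional ℚ_[p] (padicCoeffField S)] (lam : padicCoeffIntegers S →+ ℤ_[p])
  (hlam : ∀ (c : ℤ_[p]) (y : padicCoeffIntegers S), lam (padicIntToCoeffIntegers S c * y) = c * lam y)
  (θ : FramedGaloisRep K (padicCoeffIntegers S) 1)
  {V : WeierstrassCurve K} {j : V.geomPrimaryTorsion p →+ Cofree θ (padicCoeffField S)} {S₀ : Set (HeightOneSpectrum (𝓞 K))} {ε : ℤˣ}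
  (D : SignedTransportDualDataSat κ γ (Cofree θ (padicCoeffField S)) (padicCoeffIntegers S) V j S₀ ε)
  {v : HeightOneSpectrum (𝓞 K)} [inst : DistribMulAction (absoluteGaloisGroup (v.adicCompletion K)) (Cofree θ (padicCoeffField S))]
  [SMulCommClass (absoluteGaloisGroup (v.adicCompletion K)) (padicCoeffIntegers S) (Cofree θ (padicCoeffField S))]
  {γv : absoluteGaloisGroup (v.adicCompletion K)} (DQ : LocalCondDualData κ (Cofree θ (padicCoeffField S)) (padicCoeffIntegers S) V j ε v γv)
  (hres : ∀ (σ : absoluteGaloisGroup (v.adicCompletion K)) (m : Cofree θ (padicCoeffField S)), σ • m = resGalOfEmb (closureEmb (K := K) (v.adicCompletion K)) σ • m)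
  (hvp : (p : 𝓞 K) ∈ v.asIdeal)
  {γB : absoluteGaloisGroup K} {θ' : absoluteGaloisGroup K →ₜ* (padicCoeffIntegers S)ˣ} {P : Set (HeightOneSpectrum (𝓞 K))}
  (I : CycIwasawaCohomologyDataO S κ γB θ' P 1)
  (hstab : ∀ m : Cofree θ (padicCoeffField S),
    IsOpen (MulAction.stabilizer (absoluteGaloisGroup (v.adicCompletion K)) m : Set (absoluteGaloisGroup (v.adicCompletion K))))
  (hθ : ∀ σ : absoluteGaloisGroup K,
    ((θ' σ : (padicCoeffIntegers S)ˣ) : padicCoeffIntegers S) * ((θ σ : GL (Fin 1) (padicCoeffIntegers S)) : Matrix (Fin 1) (Fin 1) (padicCoeffIntegers S)) 0 0 = 1)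
  (htor : ∀ m : Cofree θ (padicCoeffField S), ∃ k : ℕ, p ^ k • m = 0)
  (hγB : γB * resGalOfEmb (closureEmb (K := K) (v.adicCompletion K)) γv ∈ κ.kerSubgroup)
  (hNP : ∀ n, ramificationSubgroup K P ≤ κ.layerSubgroup n) (hv : AcSigned.IsNonsplitIn κ v)

include hv in
/-- ★★★ **S2 OF THE v22 DESIGN FOR THE LEAD's `M = Cofree θ F`**: EVERY `jv : B = I.H →ₗ[Λ_𝒪] DQ.X` with the pin `DQ.toDual (jv b) = (𝓛.towerPairing I).pairing hstab b`
(`𝓛 = layerPairingOf … (cofreeLamCoeffPairing S lam hlam …) …`; such `jv` exists uniquely, §1) satisfies `Function.Exact (jv ∘ₗ B′.subtype) gX` on the strict carrier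
`B′ = strictCarrier I (strictLevel S κ θ′ P S₀)`, under the hypotheses of `exists_junction_exact_cofree_lam_free` (frame + `hperf`; no `RSeq`, no `hsolL`, no `S₀ ⊆ P`).
[cite: Kobayashi2003, Thm. 7.3 i)] [cite: Rubin2000, Thm. 1.7.3, §4.2] [cite: NeukirchSchmidtWingberg2008, VIII §6, (7.2.6)] [cite: Kato2004Asterisque, §17.13] -/
theorem exact_junctionMap_comp_subtype_cofree_lam_free [IsTotallyComplex K]
    (hinst : inst = localAction (closureEmb (K := K) (v.adicCompletion K)) (Cofree θ (padicCoeffField S)))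
    (instX : Module (IwasawaAlgebraO S) D.X) (instQ : Module (IwasawaAlgebraO S) DQ.X)
    (hιX : ∀ (f : IwasawaAlgebra p) (x : D.X), (letI := instX; iwasawaToIwasawaO S f • x) = f • x)
    (hιQ : ∀ (f : IwasawaAlgebra p) (x : DQ.X), (letI := instQ; iwasawaToIwasawaO S f • x) = f • x)
    (hCX : ∀ (a : padicCoeffIntegers S) (x : D.X) (s : signedTransportSelmerInftySat κ (Cofree θ (padicCoeffField S)) (padicCoeffIntegers S) V j S₀ ε),
      D.toDual (letI := instX; (PowerSeries.C a : IwasawaAlgebraO S) • x) s =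
        D.toDual x ⟨GreenbergSelmer.scalarH1 κ.kerSubgroup (Cofree θ (padicCoeffField S)) a s,
          scalarH1_mem_signedTransportSelmerInftySat κ (Cofree θ (padicCoeffField S)) (padicCoeffIntegers S) V j S₀ ε a s.2⟩)
    (hCQ : ∀ (a : padicCoeffIntegers S) (x : DQ.X) (c : localCondInftySat κ (Cofree θ (padicCoeffField S)) (padicCoeffIntegers S) V j ε v),
      DQ.toDual (letI := instQ; (PowerSeries.C a : IwasawaAlgebraO S) • x) c = DQ.toDual x (scalarLocalSat κ (Cofree θ (padicCoeffField S)) (padicCoeffIntegers S) V j ε v a c))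
    (hstabK : ∀ m : Cofree θ (padicCoeffField S), IsOpen (MulAction.stabilizer (absoluteGaloisGroup K) m : Set (absoluteGaloisGroup K)))
    (hγ : κ.IsTopGenerator γ) (hγv : κ.IsTopGenerator (resGalOfEmb (closureEmb (K := K) (v.adicCompletion K)) γv)) (hP : P.Finite)
    (hS₀ : S₀.Finite) (hPS₀ : ∀ w ∈ P, w ∉ S₀ → w = v) (hpv : ∀ w : HeightOneSpectrum (𝓞 K), ((p : ℕ) : 𝓞 K) ∈ w.asIdeal → w = v)
    (hMP : ∀ w : HeightOneSpectrum (𝓞 K), w ∉ P → ∀ 𝔓 ∈ w.primesAbove, ∀ τ ∈ 𝔓.inertia (absoluteGaloisGroup K), ∀ m : Cofree θ (padicCoeffField S), τ • m = m)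
    (hvS₀ : v ∉ S₀) (hvP : v ∈ P)
    (hperf : ∀ m : ℕ, Bijective fun a : ↥(torsionPow (Cofree θ (padicCoeffField S)) p m) ↦ (cofreeLamCoeffPairingK S lam hlam θ' P θ hstabK hθ m).toLin.flip a)
    (jv : letI := instQ; I.H →ₗ[IwasawaAlgebraO S] DQ.X)
    (hjv : ∀ b : I.H, DQ.toDual (jv b) =
      ((layerPairingOf S κ θ' P v (Cofree θ (padicCoeffField S)) hstab (cofreeLamCoeffPairing S lam hlam θ' P v θ hres hstab hθ) htor γB γv hγB hNP hv
        (cofreeLamCoeffPairing_hPred S lam hlam θ' P v θ hres hstab hθ) (cofreeLamCoeffPairing_hPsc S lam hlam θ' P v θ hres hstab hθ)).towerPairing I).pairing hstab b) :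
    letI := instX; letI := instQ
    Function.Exact (jv ∘ₗ (strictCarrier I (strictLevel S κ θ' P S₀) (fun n k f _ hy ↦ smul_mem_strictLevel S κ θ' P S₀ γB n k f hy)).subtype)
      (gXLinearMapO S D DQ hres hvp instX instQ hιX hιQ hCX hCQ htor hstabK hstab hγ hv hγv) :=
  exact_comp_subtype_of_junction_pin S D DQ hres hvp _ I hstab instX instQ hιX hιQ hCX hCQ htor hstabK hγ hv hγv (strictLevel S κ θ' P S₀)
    (fun n k f _ hy ↦ smul_mem_strictLevel S κ θ' P S₀ γB n k f hy)
    (exists_junction_exact_cofree_lam_free S lam hlam θ D DQ hres hvp I hstab hθ htor hγB hNP hv hinst instX instQ hιX hιQ hCX hCQ hstabK hγ hγv hP hS₀ hPS₀ hpv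
      hMP hvS₀ hvP hperf) jv hjv

end Cofree

end Summit.BirchSwinnertonDyer.BirchSwinnertonDyer.Theorems.SmallImageRttD2Seq

end
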